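import Summits.AtomisticToContinuum.Crystallization.Theorems.FreeSplittingCertificatesStrictSplittingRuleP1Chart

/-!
# `StrictSplittingRule` (stmt-AtomisticToContinuum-12560): the closed-form HAT FUNCTION of a site of the hcp tet–oct honeycomb (P1 interpolant object, part 2)

Route `FreeSplittingCertificates`, crux r3 `StrictSplittingRule` (H12⋆ = `stub_coreJointCoercive`), unit b2b-freesplit-B gen 20.
VALUE = second brick of item (2) of HOME FAR-LEMMA-SPEC §15 (d) (the P1 INTERPOLANT OBJECT).  NOT a proof of H12⋆, NOT summit progress.

In chart coordinates `p = (t, x, y)` (layer, `i`, `j` offsets relative to a site; chart `p1Chart` of part 1) the nodal hat function of the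
P1 interpolant on the tet–quarter-oct decomposition (cells in part 3) has the CLOSED FORM `p1Hat e p = max(0, 1 − p1Gauge e p)` with the
polyhedral gauge `p1Gauge e (t,x,y) = max(sx+sy+|t|, −sx, sy+|t|, −sy, sx, |t|, −sx−sy)`, `s = +1` for an even-layer site (`e = true`), `−1`
for an odd-layer site: the star of a site (its 24 tetrahedra) is the polytope `{p1Gauge ≤ 1}`.  Consequences here: the ten linear minorants
and the matching upper-bound rule (the interface of the decision lemmas of part 4), `‖p‖_∞ ≤ p1Gauge`, values in `[0,1]`, support in the
open unit sup-ball, value `1` at the site, continuity — so the interpolant `Σ_n φ_n U_n` (part 5) is a locally finite sum of continuous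
functions.  [folklore: P1 finite elements]
-/

noncomputable section

open Set

namespace Summit.AtomisticToContinuum.Crystallization.Theorems.StrictSplittingRuleBirth

/-! ## The gauge and the hat function -/

/-- Orientation sign of a site's star: `+1` on even layers (`e = true`), `−1` on odd layers. -/
def p1S : Bool → ℝ
  | true => 1
  | false => -1

/-- `p1S true = 1`. -/
@[simp] theorem p1S_true : p1S true = 1 := rfl

/-- `p1S false = -1`. -/
@[simp] theorem p1S_false : p1S false = -1 := rfl

/-- **The polyhedral gauge of a vertex star** (`e = true`: even-layer site; coordinates `p = (t, x, y)` relative to the site):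
`max(sx+sy+|t|, −sx, sy+|t|, −sy, sx, |t|, −sx−sy)`, `s = p1S e`.  Its unit ball is the union of the 24 tetrahedra around the site. -/
def p1Gauge (e : Bool) (p : Fin 3 → ℝ) : ℝ :=
  max (max (max (max (max (max (p1S e * p 1 + p1S e * p 2 + |p 0|) (-(p1S e * p 1))) (p1S e * p 2 + |p 0|))
    (-(p1S e * p 2))) (p1S e * p 1)) |p 0|) (-(p1S e * p 1) - p1S e * p 2)

/-- **The nodal hat function** of a site, in closed form: `max(0, 1 − gauge)`. -/
def p1Hat (e : Bool) (p : Fin 3 → ℝ) : ℝ := max 0 (1 - p1Gauge e p)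

/-- The ten linear minorants of the gauge (the seven terms, with `|t|` split into `±t`). -/
theorem p1Gauge_ge_all (e : Bool) (p : Fin 3 → ℝ) :
    p1S e * p 1 + p1S e * p 2 + p 0 ≤ p1Gauge e p ∧ p1S e * p 1 + p1S e * p 2 - p 0 ≤ p1Gauge e p ∧
    -(p1S e * p 1) ≤ p1Gauge e p ∧ p1S e * p 2 + p 0 ≤ p1Gauge e p ∧ p1S e * p 2 - p 0 ≤ p1Gauge e p ∧
    -(p1S e * p 2) ≤ p1Gauge e p ∧ p1S e * p 1 ≤ p1Gauge e p ∧ p 0 ≤ p1Gauge e p ∧ -p 0 ≤ p1Gauge e p ∧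
    -(p1S e * p 1) - p1S e * p 2 ≤ p1Gauge e p := by
  have h1 : p 0 ≤ |p 0| := le_abs_self _
  have h2 : -p 0 ≤ |p 0| := neg_le_abs _
  unfold p1Gauge
  refine ⟨?_, ?_, ?_, ?_, ?_, ?_, ?_, ?_, ?_, ?_⟩ <;>
    simp only [le_max_iff] <;>
    first
    | exact Or.inl (Or.inl (Or.inl (Or.inl (Or.inl (Or.inl (by linarith))))))
    | exact Or.inl (Or.inl (Or.inl (Or.inl (Or.inl (Or.inr (by linarith))))))
    | exact Or.inl (Or.inl (Or.inl (Or.inl (Or.inr (by linarith)))))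
    | exact Or.inl (Or.inl (Or.inl (Or.inr (by linarith))))
    | exact Or.inl (Or.inl (Or.inr (by linarith)))
    | exact Or.inl (Or.inr (by linarith))
    | exact Or.inr (by linarith)

/-- Upper bound for the gauge from bounds on its ten linear minorants. -/
theorem p1Gauge_le_of (e : Bool) (p : Fin 3 → ℝ) (b : ℝ) (h1 : p1S e * p 1 + p1S e * p 2 + p 0 ≤ b)
    (h2 : p1S e * p 1 + p1S e * p 2 - p 0 ≤ b) (h3 : -(p1S e * p 1) ≤ b) (h4 : p1S e * p 2 + p 0 ≤ b)
    (h5 : p1S e * p 2 - p 0 ≤ b) (h6 : -(p1S e * p 2) ≤ b) (h7 : p1S e * p 1 ≤ b) (h8 : p 0 ≤ b) (h9 : -p 0 ≤ b)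
    (h10 : -(p1S e * p 1) - p1S e * p 2 ≤ b) : p1Gauge e p ≤ b := by
  unfold p1Gauge
  rcases abs_cases (p 0) with ⟨hp, -⟩ | ⟨hp, -⟩ <;> rw [hp] <;> simp only [max_le_iff] <;>
    refine ⟨⟨⟨⟨⟨⟨?_, ?_⟩, ?_⟩, ?_⟩, ?_⟩, ?_⟩, ?_⟩ <;> linarith

/-- The gauge dominates the sup norm. -/
theorem norm_le_p1Gauge (e : Bool) (p : Fin 3 → ℝ) : ‖p‖ ≤ p1Gauge e p := by
  obtain ⟨-, -, k3, k4, k5, k6, k7, k8, k9, -⟩ := p1Gauge_ge_all e p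
  have hs : p1S e = 1 ∨ p1S e = -1 := by cases e <;> simp
  have h1 : |p 1| ≤ p1Gauge e p := by
    rw [abs_le]; rcases hs with hs | hs <;> rw [hs] at k3 k7 <;> constructor <;> linarith
  have h2 : |p 2| ≤ p1Gauge e p := by
    rw [abs_le]; rcases hs with hs | hs <;> rw [hs] at k4 k5 k6 <;> constructor <;> linarith
  have h0 : |p 0| ≤ p1Gauge e p := abs_le.2 ⟨by linarith, k8⟩
  rw [pi_norm_le_iff_of_nonneg (le_trans (abs_nonneg _) h0)]
  intro i
  rw [Real.norm_eq_abs]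
  fin_cases i
  exacts [h0, h1, h2]

/-- From the ten minorants: a lower bound on the gauge yields an upper bound on `1 − gauge` (rule form, unifies with the goal). -/
theorem p1Gauge_oneSub_le_aux {e : Bool} {p : Fin 3 → ℝ} {b : ℝ}
    (H : ∀ G : ℝ, (p1S e * p 1 + p1S e * p 2 + p 0 ≤ G ∧ p1S e * p 1 + p1S e * p 2 - p 0 ≤ G ∧
      -(p1S e * p 1) ≤ G ∧ p1S e * p 2 + p 0 ≤ G ∧ p1S e * p 2 - p 0 ≤ G ∧ -(p1S e * p 2) ≤ G ∧ p1S e * p 1 ≤ G ∧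
      p 0 ≤ G ∧ -p 0 ≤ G ∧ -(p1S e * p 1) - p1S e * p 2 ≤ G) → 1 - G ≤ b) :
    1 - p1Gauge e p ≤ b :=
  H _ (p1Gauge_ge_all e p)

/-- The hat function takes values in `[0, 1]`. -/
theorem p1Hat_mem_Icc (e : Bool) (p : Fin 3 → ℝ) : p1Hat e p ∈ Icc (0 : ℝ) 1 := by
  refine ⟨le_max_left _ _, max_le zero_le_one ?_⟩
  linarith [norm_le_p1Gauge e p, norm_nonneg p]

/-- The hat function is nonnegative. -/
theorem p1Hat_nonneg (e : Bool) (p : Fin 3 → ℝ) : 0 ≤ p1Hat e p := (p1Hat_mem_Icc e p).1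

/-- **Support**: the hat function vanishes outside the open unit sup-ball. -/
theorem p1Hat_eq_zero_of_norm {e : Bool} {p : Fin 3 → ℝ} (hp : 1 ≤ ‖p‖) : p1Hat e p = 0 :=
  max_eq_left (by linarith [norm_le_p1Gauge e p])

/-- If the hat function is nonzero, the point is within sup-distance `< 1` of the site. -/
theorem norm_lt_one_of_p1Hat_ne_zero {e : Bool} {p : Fin 3 → ℝ} (hp : p1Hat e p ≠ 0) : ‖p‖ < 1 := by
  by_contra h
  exact hp (p1Hat_eq_zero_of_norm (not_lt.1 h))

/-- The hat function is `1` at its own site. -/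
theorem p1Hat_zero (e : Bool) : p1Hat e 0 = 1 := by
  simp [p1Hat, p1Gauge]

/-- The gauge is continuous. -/
theorem continuous_p1Gauge (e : Bool) : Continuous (p1Gauge e) := by
  have h0 : Continuous fun p : Fin 3 → ℝ => p 0 := continuous_apply 0
  have h1 : Continuous fun p : Fin 3 → ℝ => p1S e * p 1 := continuous_const.mul (continuous_apply 1)
  have h2 : Continuous fun p : Fin 3 → ℝ => p1S e * p 2 := continuous_const.mul (continuous_apply 2)
  unfold p1Gauge
  exact (((((((h1.add h2).add h0.abs).max h1.neg).max (h2.add h0.abs)).max h2.neg).max h1).max h0.abs).max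
    (h1.neg.sub h2)

/-- The hat function is continuous. -/
theorem continuous_p1Hat (e : Bool) : Continuous (p1Hat e) :=
  continuous_const.max (continuous_const.sub (continuous_p1Gauge e))

end Summit.AtomisticToContinuum.Crystallization.Theorems.StrictSplittingRuleBirth
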